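import Summits.AtomisticToContinuum.FouriersLaw.Theorems.BondHeatUncertaintySubdiffusiveBondHeatJunctionRatioFirstBondBracket

/-!
# BondHeatUncertainty › SubdiffusiveBondHeat › JunctionRatio › TransferAtoms

First of six files proving OUTRIGHT the leaf **[LM] `TransferMoment`** of
`JunctionRatioFirstBondBracket` (uniform Gibbs second moments of the hot/cold second-order test
observables `Ψ_T(0,1) = L_T(L_T ψ) − γ L_T ψ + (U″(q_0) + V″(q_1 − q_0)) ψ`, `ψ = p_1/V″(q_1 − q_0)`, and its
mirror image), so that the leaf list beneath `RootPositivity 1` on the 11071 line shrinks to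
`FirstBondBracket` [BI] (given the supports `ResponseRegularity`, `FirstOrderEntropyProduction`).

This file: the one-variable building blocks `φ = 1/V″`, `φ′`, `φ″`, `U′ = pinForce`, `U″`, `V′ = bondForce`,
`V″` with their derivatives (§A), coordinate-update calculus for `partialQ`/`partialP` (§B), the forces
`∂_{q_0}H`, `∂_{q_1}H` of `pinnedChain` (§C), and the hot-end geometry: sites `0, 1, 2`, the partial
derivatives of the test observable `ψ = transferTest β N 0 1` and the explicit formula for `L ψ` (§D).
Chain: TransferAtoms → TransferCalculus → TransferSize → TransferBound; SiteMarginal; both →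
TransferMoment (`transferMoment_holds : TransferMoment`). All [calculus]; constants never depend on `N`.
-/

noncomputable section

open MeasureTheory Filter Topology Set
open scoped BigOperators

namespace Summit.AtomisticToContinuum.FouriersLaw.Theorems.SubdiffusiveBondHeat

namespace EscapeGrading

open Literature.MathematicalPhysics.KineticTheory.HeatConduction

variable {N : ℕ} {ω₂ lam β γ : ℝ}

/-! ## A. One-variable building blocks: `φ = 1/V″`, `φ′`, `φ″`, `U′`, `V′` and their derivatives -/

/-- `φ(r) = 1 / V″(r) = 1/(1 + 3βr²)`. -/
def transferPhi (β r : ℝ) : ℝ := 1 / (1 + 3 * β * r ^ 2)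

/-- `φ′(r) = −6βr/(1 + 3βr²)²`. -/
def transferDPhi (β r : ℝ) : ℝ := -(6 * β * r) / (1 + 3 * β * r ^ 2) ^ 2

/-- `φ″(r) = 6β(9βr² − 1)/(1 + 3βr²)³`. -/
def transferDDPhi (β r : ℝ) : ℝ := 6 * β * (9 * β * r ^ 2 - 1) / (1 + 3 * β * r ^ 2) ^ 3

/-- `U′(a) = ω₂ a + λ a³` (pinning force of `pinnedChain`). -/
def pinForce (ω₂ lam a : ℝ) : ℝ := ω₂ * a + lam * a ^ 3

/-- `U″(a) = ω₂ + 3λ a²`. -/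
def pinStiff (ω₂ lam a : ℝ) : ℝ := ω₂ + 3 * lam * a ^ 2

/-- `V′(r) = r + β r³` (bond force of `pinnedChain`). -/
def bondForce (β r : ℝ) : ℝ := r + β * r ^ 3

/-- `V″(r) = 1 + 3β r²`. -/
def bondStiff (β r : ℝ) : ℝ := 1 + 3 * β * r ^ 2

/-- `d/dr (1 + 3βr²) = 6βr`. [calculus] -/
theorem hasDerivAt_one_add (β r : ℝ) : HasDerivAt (fun r : ℝ => 1 + 3 * β * r ^ 2) (6 * β * r) r := by
  have h := (((hasDerivAt_id' r).fun_mul (hasDerivAt_id' r)).const_mul (3 * β)).const_add 1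
  have e : (fun r : ℝ => 1 + 3 * β * r ^ 2) = fun x : ℝ => 1 + 3 * β * (x * x) := by
    funext x; ring
  rw [e]
  exact h.congr_deriv (by ring)

/-- `φ′` is the derivative of `φ`. [calculus] -/
theorem hasDerivAt_transferPhi (hβ : 0 ≤ β) (r : ℝ) : HasDerivAt (transferPhi β) (transferDPhi β r) r := by
  have hD : (1 + 3 * β * r ^ 2) ≠ 0 := (by positivity : (0 : ℝ) < 1 + 3 * β * r ^ 2).ne'
  have h := (hasDerivAt_const r (1 : ℝ)).fun_div (hasDerivAt_one_add β r) hD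
  have e : transferPhi β = fun r => 1 / (1 + 3 * β * r ^ 2) := rfl
  rw [e]
  exact h.congr_deriv (by unfold transferDPhi; ring)

/-- `φ″` is the derivative of `φ′`. [calculus] -/
theorem hasDerivAt_transferDPhi (hβ : 0 ≤ β) (r : ℝ) : HasDerivAt (transferDPhi β) (transferDDPhi β r) r := by
  have hD : (1 + 3 * β * r ^ 2) ≠ 0 := (by positivity : (0 : ℝ) < 1 + 3 * β * r ^ 2).ne'
  have hnum : HasDerivAt (fun r : ℝ => -(6 * β * r)) (-(6 * β * 1)) r :=
    ((hasDerivAt_id' r).const_mul (6 * β)).fun_neg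
  have hden : HasDerivAt (fun r : ℝ => (1 + 3 * β * r ^ 2) ^ 2)
      ((1 + 3 * β * r ^ 2) * (6 * β * r) + (6 * β * r) * (1 + 3 * β * r ^ 2)) r := by
    have h2 := (hasDerivAt_one_add β r).fun_mul (hasDerivAt_one_add β r)
    have e : (fun r : ℝ => (1 + 3 * β * r ^ 2) ^ 2) = fun x : ℝ => (1 + 3 * β * x ^ 2) * (1 + 3 * β * x ^ 2) := by
      funext x; ring
    rw [e]
    exact h2.congr_deriv (by ring)
  have h := hnum.fun_div hden (pow_ne_zero 2 hD)
  have e : transferDPhi β = fun r => -(6 * β * r) / (1 + 3 * β * r ^ 2) ^ 2 := rfl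
  rw [e]
  exact h.congr_deriv (by unfold transferDDPhi; field_simp; ring)

/-- `U″` is the derivative of `U′`. [calculus] -/
theorem hasDerivAt_pinForce (ω₂ lam a : ℝ) : HasDerivAt (pinForce ω₂ lam) (pinStiff ω₂ lam a) a := by
  have h := ((hasDerivAt_id' a).const_mul ω₂).fun_add
    ((((hasDerivAt_id' a).fun_mul (hasDerivAt_id' a)).fun_mul (hasDerivAt_id' a)).const_mul lam)
  have e : pinForce ω₂ lam = fun x => ω₂ * x + lam * (x * x * x) := by
    funext x; unfold pinForce; ring
  rw [e]
  exact h.congr_deriv (by unfold pinStiff; ring)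

/-- `V″` is the derivative of `V′`. [calculus] -/
theorem hasDerivAt_bondForce (β r : ℝ) : HasDerivAt (bondForce β) (bondStiff β r) r := by
  have h := (hasDerivAt_id' r).fun_add
    ((((hasDerivAt_id' r).fun_mul (hasDerivAt_id' r)).fun_mul (hasDerivAt_id' r)).const_mul β)
  have e : bondForce β = fun x => x + β * (x * x * x) := by
    funext x; unfold bondForce; ring
  rw [e]
  exact h.congr_deriv (by unfold bondStiff; ring)

/-- `6λa` is the derivative of `U″`. [calculus] -/
theorem hasDerivAt_pinStiff (ω₂ lam a : ℝ) : HasDerivAt (pinStiff ω₂ lam) (6 * lam * a) a := by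
  have h := (((hasDerivAt_id' a).fun_mul (hasDerivAt_id' a)).const_mul (3 * lam)).const_add ω₂
  have e : pinStiff ω₂ lam = fun x => ω₂ + 3 * lam * (x * x) := by
    funext x; unfold pinStiff; ring
  rw [e]
  exact h.congr_deriv (by ring)

/-- `6βr` is the derivative of `V″`. [calculus] -/
theorem hasDerivAt_bondStiff (β r : ℝ) : HasDerivAt (bondStiff β) (6 * β * r) r := by
  have e : bondStiff β = fun r => 1 + 3 * β * r ^ 2 := rfl
  rw [e]
  exact hasDerivAt_one_add β r

/-- `φ` is continuous (`β ≥ 0`). [calculus] -/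
theorem continuous_transferPhi (hβ : 0 ≤ β) : Continuous (transferPhi β) :=
  continuous_const.div (by fun_prop) fun r => (by positivity : (0 : ℝ) < 1 + 3 * β * r ^ 2).ne'

/-- `φ′` is continuous (`β ≥ 0`). [calculus] -/
theorem continuous_transferDPhi (hβ : 0 ≤ β) : Continuous (transferDPhi β) :=
  Continuous.div (by fun_prop) (by fun_prop) fun r => pow_ne_zero 2 (by positivity : (0 : ℝ) < 1 + 3 * β * r ^ 2).ne'

/-- `φ″` is continuous (`β ≥ 0`). [calculus] -/
theorem continuous_transferDDPhi (hβ : 0 ≤ β) : Continuous (transferDDPhi β) :=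
  Continuous.div (by fun_prop) (by fun_prop) fun r => pow_ne_zero 3 (by positivity : (0 : ℝ) < 1 + 3 * β * r ^ 2).ne'

/-- `U′` is continuous. [calculus] -/
theorem continuous_pinForce (ω₂ lam : ℝ) : Continuous (pinForce ω₂ lam) := by unfold pinForce; fun_prop
/-- `U″` is continuous. [calculus] -/
theorem continuous_pinStiff (ω₂ lam : ℝ) : Continuous (pinStiff ω₂ lam) := by unfold pinStiff; fun_prop
/-- `V′` is continuous. [calculus] -/
theorem continuous_bondForce (β : ℝ) : Continuous (bondForce β) := by unfold bondForce; fun_prop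
/-- `V″` is continuous. [calculus] -/
theorem continuous_bondStiff (β : ℝ) : Continuous (bondStiff β) := by unfold bondStiff; fun_prop

/-! ## B. Coordinate-update calculus -/

/-- `t ↦ q[l ↦ t] m` has derivative `δ_{ml}`. [calculus] -/
theorem hasDerivAt_update_eval (q : Fin N → ℝ) (l m : Fin N) :
    HasDerivAt (fun t => Function.update q l t m) (if m = l then 1 else 0) (q l) := by
  by_cases h : m = l
  · subst h
    simp only [Function.update_self, if_true]
    exact hasDerivAt_id _
  · simp only [Function.update_of_ne h, h, if_false]
    exact hasDerivAt_const _ _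

/-- Chain rule through one updated coordinate. [calculus] -/
theorem hasDerivAt_comp_update_eval {g : ℝ → ℝ} {g' : ℝ} (q : Fin N → ℝ) (m l : Fin N)
    (hg : HasDerivAt g g' (q m)) :
    HasDerivAt (fun t => g (Function.update q l t m)) (g' * (if m = l then 1 else 0)) (q l) := by
  have hev : Function.update q l (q l) m = q m := by simp
  have hg' : HasDerivAt g g' (Function.update q l (q l) m) := by rw [hev]; exact hg
  exact hg'.comp (q l) (hasDerivAt_update_eval q l m)

/-- Chain rule through a difference of two updated coordinates. [calculus] -/
theorem hasDerivAt_comp_update_sub {g : ℝ → ℝ} {g' : ℝ} (q : Fin N → ℝ) (a b l : Fin N)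
    (hg : HasDerivAt g g' (q a - q b)) :
    HasDerivAt (fun t => g (Function.update q l t a - Function.update q l t b))
      (g' * ((if a = l then 1 else 0) - (if b = l then 1 else 0))) (q l) := by
  have hev : Function.update q l (q l) a - Function.update q l (q l) b = q a - q b := by simp
  have hg' : HasDerivAt g g' (Function.update q l (q l) a - Function.update q l (q l) b) := by
    rw [hev]; exact hg
  exact hg'.comp (q l) ((hasDerivAt_update_eval q l a).fun_sub (hasDerivAt_update_eval q l b))

/-- Kronecker collapse `Σ_l f_l · c · δ_{al} = c f_a`. [calculus] -/
theorem sum_mul_mul_ite (f : Fin N → ℝ) (a : Fin N) (c : ℝ) :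
    ∑ l : Fin N, f l * (c * (if a = l then (1 : ℝ) else 0)) = c * f a := by
  have e : ∀ l : Fin N, f l * (c * (if a = l then (1 : ℝ) else 0)) = if a = l then c * f a else 0 := by
    intro l
    split_ifs with h
    · subst h; ring
    · ring
  rw [Finset.sum_congr rfl fun l _ => e l, Finset.sum_ite_eq]
  simp

/-! ## C. The forces at the two hot-end sites (`N ≥ 3`) -/

/-- `(pinnedChain).U′ = pinForce` as functions. [calculus] -/
theorem pinnedChain_deriv_U_eq_pinForce (ω₂ lam β γ : ℝ) :
    deriv (pinnedChain ω₂ lam β γ).U = pinForce ω₂ lam :=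
  funext fun a => by rw [pinnedChain_deriv_U]; rfl

/-- `(pinnedChain).V′ = bondForce` as functions. [calculus] -/
theorem pinnedChain_deriv_V_eq_bondForce (ω₂ lam β γ : ℝ) :
    deriv (pinnedChain ω₂ lam β γ).V = bondForce β :=
  funext fun r => by rw [pinnedChain_deriv_V]; rfl

/-- `∂_{q_0}H = U′(q_0) − V′(q_1 − q_0)` (`N ≥ 3`). [calculus] -/
theorem partialQ_hamiltonian_site0 (hN : 3 ≤ N) (x : PhaseSpace N) :
    partialQ ⟨0, by omega⟩ ((pinnedChain ω₂ lam β γ).hamiltonian N) x =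
      pinForce ω₂ lam (x.1 ⟨0, by omega⟩) - bondForce β (x.1 ⟨1, by omega⟩ - x.1 ⟨0, by omega⟩) := by
  rw [Literature.Barriers.AtomisticToContinuum.partialQ_hamiltonian (pinnedChain ω₂ lam β γ)
    ((pinnedChain_contDiff_U ω₂ lam β γ (n := 1)).differentiable one_ne_zero)
    ((pinnedChain_contDiff_V ω₂ lam β γ (n := 1)).differentiable one_ne_zero),
    pinnedChain_deriv_U_eq_pinForce, pinnedChain_deriv_V_eq_bondForce]
  unfold Literature.Barriers.AtomisticToContinuum.leftTerm Literature.Barriers.AtomisticToContinuum.rightTerm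
  have h1 : (0 : ℕ) + 1 < N := by omega
  simp [h1]

/-- `∂_{q_1}H = U′(q_1) + V′(q_1 − q_0) − V′(q_2 − q_1)` (`N ≥ 3`). [calculus] -/
theorem partialQ_hamiltonian_site1 (hN : 3 ≤ N) (x : PhaseSpace N) :
    partialQ ⟨1, by omega⟩ ((pinnedChain ω₂ lam β γ).hamiltonian N) x =
      pinForce ω₂ lam (x.1 ⟨1, by omega⟩) + bondForce β (x.1 ⟨1, by omega⟩ - x.1 ⟨0, by omega⟩)
        - bondForce β (x.1 ⟨2, by omega⟩ - x.1 ⟨1, by omega⟩) := by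
  rw [Literature.Barriers.AtomisticToContinuum.partialQ_hamiltonian (pinnedChain ω₂ lam β γ)
    ((pinnedChain_contDiff_U ω₂ lam β γ (n := 1)).differentiable one_ne_zero)
    ((pinnedChain_contDiff_V ω₂ lam β γ (n := 1)).differentiable one_ne_zero),
    pinnedChain_deriv_U_eq_pinForce, pinnedChain_deriv_V_eq_bondForce]
  unfold Literature.Barriers.AtomisticToContinuum.leftTerm Literature.Barriers.AtomisticToContinuum.rightTerm
  have h1 : (1 : ℕ) + 1 < N := by omega
  simp [h1]

/-! ## D. The hot-end geometry (`N ≥ 3`): sites `0, 1, 2`, the test observable and `Lψ` -/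

/-- Site `0` of a chain with at least three sites. -/
abbrev site0 (hN : 3 ≤ N) : Fin N := ⟨0, by omega⟩

/-- Site `1` of a chain with at least three sites. -/
abbrev site1 (hN : 3 ≤ N) : Fin N := ⟨1, by omega⟩

/-- Site `2` of a chain with at least three sites. -/
abbrev site2 (hN : 3 ≤ N) : Fin N := ⟨2, by omega⟩

/-- The value of `site0` is `0`. [bookkeeping] -/
@[simp] theorem site0_val (hN : 3 ≤ N) : (site0 hN).val = 0 := rfl
/-- The value of `site1` is `1`. [bookkeeping] -/
@[simp] theorem site1_val (hN : 3 ≤ N) : (site1 hN).val = 1 := rfl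
/-- The value of `site2` is `2`. [bookkeeping] -/
@[simp] theorem site2_val (hN : 3 ≤ N) : (site2 hN).val = 2 := rfl

/-- `0 ≠ 1` in `Fin N`. [bookkeeping] -/
theorem site0_ne_site1 (hN : 3 ≤ N) : site0 hN ≠ site1 hN := by simp [Fin.ext_iff]
/-- `0 ≠ 2` in `Fin N`. [bookkeeping] -/
theorem site0_ne_site2 (hN : 3 ≤ N) : site0 hN ≠ site2 hN := by simp [Fin.ext_iff]
/-- `1 ≠ 2` in `Fin N`. [bookkeeping] -/
theorem site1_ne_site2 (hN : 3 ≤ N) : site1 hN ≠ site2 hN := by simp [Fin.ext_iff]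

/-- `ψ_{ij} = p_j · φ(q_j − q_i)`. -/
theorem transferTest_eq (β : ℝ) (N : ℕ) (i j : Fin N) :
    transferTest β N i j = fun x => x.2 j * transferPhi β (x.1 j - x.1 i) := by
  funext x
  unfold transferTest transferPhi
  rw [div_eq_mul_one_div]

/-- `∂_{q_l} ψ_{ij} = p_j φ′(q_j − q_i)(δ_{jl} − δ_{il})`. [calculus] -/
theorem partialQ_transferTest (hβ : 0 ≤ β) (i j l : Fin N) (x : PhaseSpace N) :
    partialQ l (transferTest β N i j) x =
      x.2 j * (transferDPhi β (x.1 j - x.1 i) * ((if j = l then 1 else 0) - (if i = l then 1 else 0))) := by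
  rw [transferTest_eq]
  unfold partialQ
  have key : HasDerivAt (fun t => (fun y : PhaseSpace N => y.2 j * transferPhi β (y.1 j - y.1 i))
      (Function.update x.1 l t, x.2)) _ (x.1 l) :=
    (hasDerivAt_comp_update_sub x.1 j i l (hasDerivAt_transferPhi hβ _)).const_mul (x.2 j)
  exact key.deriv

/-- `∂_{p_l} ψ_{ij} = δ_{jl} φ(q_j − q_i)`. [calculus] -/
theorem partialP_transferTest (β : ℝ) (i j l : Fin N) (x : PhaseSpace N) :
    partialP l (transferTest β N i j) x = (if j = l then 1 else 0) * transferPhi β (x.1 j - x.1 i) := by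
  rw [transferTest_eq]
  unfold partialP
  have key : HasDerivAt (fun t => (fun y : PhaseSpace N => y.2 j * transferPhi β (y.1 j - y.1 i))
      (x.1, Function.update x.2 l t)) _ (x.2 l) :=
    (hasDerivAt_update_eval x.2 l j).mul_const (transferPhi β (x.1 j - x.1 i))
  exact key.deriv

/-- `∂_{p_l} ψ` as a function (`partialP_transferTest` unapplied). [calculus] -/
theorem partialP_transferTest_fun (β : ℝ) (i j l : Fin N) :
    partialP l (transferTest β N i j) = fun x => (if j = l then 1 else 0) * transferPhi β (x.1 j - x.1 i) :=
  funext (partialP_transferTest β i j l)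

/-- `∂²_{p_l} ψ_{ij} = 0`. [calculus] -/
theorem partialP_partialP_transferTest (β : ℝ) (i j l : Fin N) (x : PhaseSpace N) :
    partialP l (partialP l (transferTest β N i j)) x = 0 := by
  rw [partialP_transferTest_fun]
  unfold partialP
  simp

/-- **`Lψ` at the hot end.** `L ψ_{01} = (p_1 − p_0) p_1 φ′(r) − ∂_{q_1}H · φ(r)`, `r = q_1 − q_0`; the bath part
vanishes because `ψ_{01}` does not depend on `p_0` or `p_{N−1}` (`N ≥ 3`). [calculus] -/
theorem generator_transferTest_hot (hN : 3 ≤ N) (hβ : 0 ≤ β) (T_L T_R : ℝ) (x : PhaseSpace N) :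
    (pinnedChain ω₂ lam β γ).generator N T_L T_R (transferTest β N (site0 hN) (site1 hN)) x =
      (x.2 (site1 hN) - x.2 (site0 hN)) * x.2 (site1 hN) * transferDPhi β (x.1 (site1 hN) - x.1 (site0 hN))
        - partialQ (site1 hN) ((pinnedChain ω₂ lam β γ).hamiltonian N) x
          * transferPhi β (x.1 (site1 hN) - x.1 (site0 hN)) := by
  have h01 := site0_ne_site1 hN
  unfold OscillatorChain.generator
  have hA : ∑ l : Fin N, (x.2 l * partialQ l (transferTest β N (site0 hN) (site1 hN)) x
      - partialQ l ((pinnedChain ω₂ lam β γ).hamiltonian N) x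
        * partialP l (transferTest β N (site0 hN) (site1 hN)) x)
      = (x.2 (site1 hN) - x.2 (site0 hN)) * x.2 (site1 hN) * transferDPhi β (x.1 (site1 hN) - x.1 (site0 hN))
        - partialQ (site1 hN) ((pinnedChain ω₂ lam β γ).hamiltonian N) x
          * transferPhi β (x.1 (site1 hN) - x.1 (site0 hN)) := by
    have e : ∀ l : Fin N, (x.2 l * partialQ l (transferTest β N (site0 hN) (site1 hN)) x
        - partialQ l ((pinnedChain ω₂ lam β γ).hamiltonian N) x
          * partialP l (transferTest β N (site0 hN) (site1 hN)) x)
        = (if site1 hN = l then x.2 (site1 hN) * x.2 (site1 hN) * transferDPhi β (x.1 (site1 hN) - x.1 (site0 hN))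
              - partialQ (site1 hN) ((pinnedChain ω₂ lam β γ).hamiltonian N) x
                * transferPhi β (x.1 (site1 hN) - x.1 (site0 hN)) else 0)
          + (if site0 hN = l then
              -(x.2 (site0 hN) * x.2 (site1 hN) * transferDPhi β (x.1 (site1 hN) - x.1 (site0 hN))) else 0) := by
      intro l
      rw [partialQ_transferTest hβ, partialP_transferTest]
      by_cases h1 : site1 hN = l
      · subst h1
        simp [h01]
        ring
      · by_cases h0 : site0 hN = l
        · subst h0
          simp [h1]
          ring
        · simp [h0, h1]
    rw [Finset.sum_congr rfl fun l _ => e l, Finset.sum_add_distrib, Finset.sum_ite_eq, Finset.sum_ite_eq]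
    simp only [Finset.mem_univ, if_true]
    ring
  have hB : ∑ l : Fin N, ((if l.val = 0 then
        T_L * partialP l (partialP l (transferTest β N (site0 hN) (site1 hN))) x
          - x.2 l * partialP l (transferTest β N (site0 hN) (site1 hN)) x else 0)
      + (if l.val = N - 1 then
        T_R * partialP l (partialP l (transferTest β N (site0 hN) (site1 hN))) x
          - x.2 l * partialP l (transferTest β N (site0 hN) (site1 hN)) x else 0)) = 0 := by
    refine Finset.sum_eq_zero fun l _ => ?_
    rw [partialP_partialP_transferTest, partialP_transferTest]
    by_cases hl0 : l.val = 0
    · have h1l : site1 hN ≠ l := fun h => by rw [← h] at hl0; simp at hl0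
      simp [h1l]
    · by_cases hlz : l.val = N - 1
      · have h1l : site1 hN ≠ l := fun h => by rw [← h] at hlz; simp at hlz; omega
        simp [h1l]
      · simp [hl0, hlz]
  rw [hA, hB, mul_zero, add_zero]

end EscapeGrading

end Summit.AtomisticToContinuum.FouriersLaw.Theorems.SubdiffusiveBondHeat
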